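import Literature.AlgebraicGeometry.Modules.FrameTransition
import Mathlib.Algebra.Category.ModuleCat.Sheaf.PushforwardContinuous
import HarnessLib

/-!
# Pulled-back sections of `f^*E` and their universal property

For a morphism of schemes `f : X ⟶ Y` and an `𝒪_Y`-module `E`, the unit
`η : E → f_* f^*E` of Mathlib's adjunction `Scheme.Modules.pullbackPushforwardAdjunction f` sends a
section `b ∈ Γ(E, U)` to its **pull-back** `η(b) ∈ Γ(f^*E, f⁻¹U)` (`unitSection`; the section
`f^*b = b ⊗ 1` of `f^*E = f⁻¹E ⊗_{f⁻¹𝒪_Y} 𝒪_X`, Hartshorne II.5 p. 110). Mathlib's `f^*` is abstract (a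
left adjoint), so everything about `f^*E` has to be extracted from the adjunction. This file proves
the two halves of the statement "over `f⁻¹U`, `f^*E` is generated by the pull-backs of a frame
`b_i` of `E|_U`" in the form consumed by `Modules/PullbackFrame.lean`:

* `hom_ext_of_unitSection` — **uniqueness**: two morphisms `(f^*E)|_{f⁻¹U} → N` of modules on the
  opens over `f⁻¹U` that agree on the `η(b_i)` are equal;
* `exists_dualSection` — **existence**: there are morphisms `λ_i : (f^*E)|_{f⁻¹U} → 𝒪|_{f⁻¹U}` with
  `λ_i(η(b_j)) = δ_{ij}`.

Both go through the composite adjunction `(– )|_{U'} ⊣ overExtend U'` (Mathlib's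
`SheafOfModules.overPushforwardOverAdj`, restriction to the opens over `U'` and extension along
`W ↦ U' × W`) and `f^* ⊣ f_*`: a morphism out of `(f^*E)|_{U'}` is the same as a morphism out of
`E`, computed on sections by `transpose_app` (`α ↦ (b ↦ α(η(b)|))`). Everything is proved; no
named facts.

## References

* R. Hartshorne, *Algebraic Geometry*, GTM 52 (1977), II.5 (p. 110, `f^*`). [Hartshorne1977]
* The Stacks project, Tag 01CB (functoriality of modules, `f^*` as a left adjoint). [StacksProject]
-/

noncomputable section

open CategoryTheory AlgebraicGeometry Opposite TopologicalSpace Limits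

namespace Literature.AlgebraicGeometry.Modules

open Literature.AlgebraicGeometry.Motives

universe u

variable {X Y : Scheme.{u}} (f : X ⟶ Y) (E : Y.Modules)

/-! ### Pulled-back sections -/

section UnitSection

/-- The unit `η_E : E → f_* f^* E` of the adjunction `f^* ⊣ f_*`. [folklore] -/
def pullbackUnit :
    E ⟶ (Scheme.Modules.pushforward f).obj ((Scheme.Modules.pullback f).obj E) :=
  (Scheme.Modules.pullbackPushforwardAdjunction f).unit.app E

/-- **The pull-back `η(b) ∈ Γ(f^*E, f⁻¹U)` of a section `b ∈ Γ(E, U)`** (Hartshorne II.5: the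
section `b ⊗ 1` of `f^*E`). [cite: Hartshorne1977, II.5 (p. 110)] -/
def unitSection (U : Y.Opens) (b : Γ(E, U)) : Γ((Scheme.Modules.pullback f).obj E, f ⁻¹ᵁ U) :=
  (pullbackUnit f E).app U b

/-- Pull-back of sections is additive. [folklore] -/
lemma unitSection_add (U : Y.Opens) (b b' : Γ(E, U)) :
    unitSection f E U (b + b') = unitSection f E U b + unitSection f E U b' :=
  map_add _ b b'

/-- Pull-back of sections is `f^♯`-semilinear: `η(r b) = f^♯(r) η(b)`. [folklore] -/
lemma unitSection_smul (U : Y.Opens) (r : Γ(Y, U)) (b : Γ(E, U)) :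
    unitSection f E U (r • b) = f.app U r • unitSection f E U b := by
  unfold unitSection
  rw [Scheme.Modules.Hom.app_smul]
  rfl

/-- Pull-back of sections commutes with restriction. [folklore] -/
lemma unitSection_map {U V : Y.Opens} (i : V ⟶ U) (b : Γ(E, U)) :
    unitSection f E V (E.presheaf.map i.op b) =
      ((Scheme.Modules.pullback f).obj E).presheaf.map ((Opens.map f.base).map i).op
        (unitSection f E U b) := by
  unfold unitSection
  rw [Scheme.Modules.Hom.app_map_apply]
  rfl

/-- Pull-back of a finite sum of sections. [folklore] -/
lemma unitSection_sum {ι : Type*} (t : Finset ι) (U : Y.Opens) (b : ι → Γ(E, U)) :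
    unitSection f E U (∑ a ∈ t, b a) = ∑ a ∈ t, unitSection f E U (b a) :=
  map_sum ((pullbackUnit f E).app U).hom b t

end UnitSection

/-! ### Restriction to the opens over `U'` and its right adjoint -/

section OverAdj

variable {f E} (U' : X.Opens)

/-- Extension of a module `N` on the opens over `U'` to an `𝒪_X`-module, `W ↦ N(U' × W → U')`
(push-forward along `Over.star U'`); the right adjoint of restriction `M ↦ M|_{U'}`. [folklore] -/
def overExtend : SheafOfModules.{u} (X.ringCatSheaf.over U') ⥤ X.Modules :=
  SheafOfModules.pushforward (SheafOfModules.pushforwardOver U')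

/-- **Restriction to the opens over `U'` is left adjoint to `overExtend U'`** (Mathlib's
`SheafOfModules.overPushforwardOverAdj`, retyped on `X.Modules`). [folklore] -/
def overAdj : Scheme.Modules.overFunctor U' ⊣ overExtend U' :=
  SheafOfModules.overPushforwardOverAdj U'

/-- Sections of the transpose `M → overExtend U' N` of `α : M|_{U'} → N`: restrict to `U' × W` and
apply `α`. [folklore] -/
lemma overAdj_homEquiv_app {M : X.Modules} {N : SheafOfModules.{u} (X.ringCatSheaf.over U')}
    (α : M.over U' ⟶ N) (W : X.Opens) (t : Γ(M, W)) :
    ((overAdj U').homEquiv M N α).app W t =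
      α.val.app (op ((Over.star U').obj W)) (M.presheaf.map (prod.snd : U' ⨯ W ⟶ W).op t) := by
  rw [Adjunction.homEquiv_unit]
  rfl

variable (f E)

/-- **The double transpose** of `α : (f^*E)|_{U'} → N`: the morphism `E → f_* (overExtend U' N)`
corresponding to `α` under the two adjunctions. [folklore] -/
def transpose {N : SheafOfModules.{u} (X.ringCatSheaf.over U')}
    (α : ((Scheme.Modules.pullback f).obj E).over U' ⟶ N) :
    E ⟶ (Scheme.Modules.pushforward f).obj ((overExtend U').obj N) :=
  (Scheme.Modules.pullbackPushforwardAdjunction f).homEquiv _ _ ((overAdj U').homEquiv _ _ α)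

/-- `transpose` is injective (both adjunction bijections are). [folklore] -/
lemma transpose_injective {N : SheafOfModules.{u} (X.ringCatSheaf.over U')} :
    Function.Injective (transpose f E U' (N := N)) :=
  fun _ _ h => ((overAdj U').homEquiv _ _).injective
    (((Scheme.Modules.pullbackPushforwardAdjunction f).homEquiv _ _).injective h)

/-- **Sections of the double transpose**: `(transpose α)(b) = α(η(b)|_{U' × f⁻¹W})`. [folklore] -/
theorem transpose_app {N : SheafOfModules.{u} (X.ringCatSheaf.over U')}
    (α : ((Scheme.Modules.pullback f).obj E).over U' ⟶ N) (W : Y.Opens) (b : Γ(E, W)) :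
    (transpose f E U' α).app W b =
      α.val.app (op ((Over.star U').obj (f ⁻¹ᵁ W)))
        (((Scheme.Modules.pullback f).obj E).presheaf.map (prod.snd : U' ⨯ f ⁻¹ᵁ W ⟶ f ⁻¹ᵁ W).op
          (unitSection f E W b)) := by
  rw [transpose, Adjunction.homEquiv_unit, Scheme.Modules.Hom.comp_app]
  change ((overAdj U').homEquiv _ N α).app (f ⁻¹ᵁ W) ((pullbackUnit f E).app W b) = _
  rw [overAdj_homEquiv_app]
  rfl

end OverAdj

/-! ### Morphisms in the over category of a thin category -/

section Thin

variable {U' : X.Opens}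

/-- Morphisms between opens over `U'` are unique. [folklore] -/
instance subsingleton_over_hom (V V' : Over U') : Subsingleton (V ⟶ V') :=
  ⟨fun _ _ => Over.OverMorphism.ext (Subsingleton.elim _ _)⟩

/-- A module on the opens over `U'` takes a morphism with a morphism in the opposite direction to a
bijection (the two composites are identities in the thin category `Over U'`). [folklore] -/
lemma injective_val_map_of_hom (N : SheafOfModules.{u} (X.ringCatSheaf.over U')) {V V' : Over U'}
    (g : V ⟶ V') (g' : V' ⟶ V) : Function.Injective (N.val.map g.op) := by
  intro a b h
  have h1 : N.val.map g'.op (N.val.map g.op a) = N.val.map g'.op (N.val.map g.op b) := by rw [h]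
  have key : ∀ c, N.val.map g'.op (N.val.map g.op c) = c := fun c => by
    rw [← PresheafOfModules.map_comp_apply, ← op_comp, Subsingleton.elim (g' ≫ g) (𝟙 _)]
    change N.val.presheaf.map (𝟙 (op V')) c = c
    rw [N.val.presheaf.map_id]
    rfl
  rwa [key, key] at h1

end Thin

/-! ### Uniqueness: morphisms out of `(f^*E)|_{f⁻¹U}` are determined by the pulled-back frame -/

section Uniqueness

variable {f E} {U : Y.Opens} {I : Type u} (e : SheafOfModules.free I ≅ E.over U)

/-- `U' × f⁻¹W ≤ f⁻¹(W ⊓ U)` for `U' = f⁻¹U` (the two projections). [folklore] -/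
lemma prod_le_preimage_inf (W : Y.Opens) :
    ((f ⁻¹ᵁ U) ⨯ (f ⁻¹ᵁ W) : X.Opens) ≤ f ⁻¹ᵁ (W ⊓ U) :=
  fun _ hx => ⟨(prod.snd : (f ⁻¹ᵁ U) ⨯ (f ⁻¹ᵁ W) ⟶ f ⁻¹ᵁ W).le hx,
    (prod.fst : (f ⁻¹ᵁ U) ⨯ (f ⁻¹ᵁ W) ⟶ f ⁻¹ᵁ U).le hx⟩

/-- The morphism `U' × f⁻¹W ⟶ U' × f⁻¹(W ⊓ U)` over `U' = f⁻¹U` (an inverse, in the thin category of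
opens over `U'`, of the morphism induced by `W ⊓ U ≤ W`). [folklore] -/
def starPreimageInfHom (W : Y.Opens) :
    (Over.star (f ⁻¹ᵁ U)).obj (f ⁻¹ᵁ W) ⟶ (Over.star (f ⁻¹ᵁ U)).obj (f ⁻¹ᵁ (W ⊓ U)) :=
  Over.homMk (prod.lift prod.fst (homOfLE (prod_le_preimage_inf W))) (Subsingleton.elim _ _)

/-- Over `U' = f⁻¹U`, the value of a morphism `γ : (f^*E)|_{U'} → N` on a pulled-back section
restricted to `U' × U'` is the restriction of its value over `U'`. [folklore] -/
lemma val_app_star_unitSection {N : SheafOfModules.{u} (X.ringCatSheaf.over (f ⁻¹ᵁ U))}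
    (γ : ((Scheme.Modules.pullback f).obj E).over (f ⁻¹ᵁ U) ⟶ N) (b : Γ(E, U)) :
    γ.val.app (op ((Over.star (f ⁻¹ᵁ U)).obj (f ⁻¹ᵁ U)))
        (((Scheme.Modules.pullback f).obj E).presheaf.map
          (prod.snd : (f ⁻¹ᵁ U) ⨯ (f ⁻¹ᵁ U) ⟶ f ⁻¹ᵁ U).op (unitSection f E U b)) =
      N.val.map (Over.homMk (prod.fst : (f ⁻¹ᵁ U) ⨯ (f ⁻¹ᵁ U) ⟶ f ⁻¹ᵁ U) rfl :
          (Over.star (f ⁻¹ᵁ U)).obj (f ⁻¹ᵁ U) ⟶ Over.mk (𝟙 (f ⁻¹ᵁ U))).op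
        (γ.val.app (op (Over.mk (𝟙 (f ⁻¹ᵁ U)))) (unitSection f E U b)) := by
  rw [Subsingleton.elim (prod.snd : (f ⁻¹ᵁ U) ⨯ (f ⁻¹ᵁ U) ⟶ f ⁻¹ᵁ U) prod.fst]
  exact PresheafOfModules.naturality_apply γ.val
    (Over.homMk (prod.fst : (f ⁻¹ᵁ U) ⨯ (f ⁻¹ᵁ U) ⟶ f ⁻¹ᵁ U) rfl :
      (Over.star (f ⁻¹ᵁ U)).obj (f ⁻¹ᵁ U) ⟶ Over.mk (𝟙 (f ⁻¹ᵁ U))).op (unitSection f E U b)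

/-- **Uniqueness.** Two morphisms `(f^*E)|_{f⁻¹U} → N` of modules on the opens over `f⁻¹U` which
agree on the pulled-back basis sections `η(b_i)` of a frame of `E|_U` are equal: by the two
adjunctions they correspond to morphisms `E → f_*(overExtend N)`, which are determined by their
values on the `b_i` (restriction from `W` to `W ⊓ U` being injective on the target).
[folklore] -/
theorem hom_ext_of_unitSection [Fintype I] {N : SheafOfModules.{u} (X.ringCatSheaf.over (f ⁻¹ᵁ U))}
    {α β : ((Scheme.Modules.pullback f).obj E).over (f ⁻¹ᵁ U) ⟶ N}
    (h : ∀ i, α.val.app (op (Over.mk (𝟙 (f ⁻¹ᵁ U)))) (unitSection f E U (basisSection e i)) =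
      β.val.app (op (Over.mk (𝟙 (f ⁻¹ᵁ U)))) (unitSection f E U (basisSection e i))) :
    α = β := by
  apply transpose_injective f E (f ⁻¹ᵁ U)
  apply Scheme.Modules.hom_ext
  intro W
  ext b
  -- restriction from `W` to `W ⊓ U` is injective on the target
  have hinj := injective_val_map_of_hom N
    ((Over.star (f ⁻¹ᵁ U)).map ((Opens.map f.base).map (homOfLE (inf_le_left : W ⊓ U ≤ W))))
    (starPreimageInfHom W)
  apply hinj
  change ((Scheme.Modules.pushforward f).obj ((overExtend (f ⁻¹ᵁ U)).obj N)).presheaf.map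
      (homOfLE (inf_le_left : W ⊓ U ≤ W)).op ((transpose f E _ α).app W b) =
    ((Scheme.Modules.pushforward f).obj ((overExtend (f ⁻¹ᵁ U)).obj N)).presheaf.map
      (homOfLE (inf_le_left : W ⊓ U ≤ W)).op ((transpose f E _ β).app W b)
  rw [← Scheme.Modules.Hom.app_map_apply, ← Scheme.Modules.Hom.app_map_apply]
  -- expand `b|_{W ⊓ U}` in the frame
  generalize E.presheaf.map (homOfLE (inf_le_left : W ⊓ U ≤ W)).op b = b'
  rw [eq_sum_coord_smul e (homOfLE inf_le_right) b', map_sum, map_sum]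
  refine Finset.sum_congr rfl fun i _ => ?_
  rw [Scheme.Modules.Hom.app_smul, Scheme.Modules.Hom.app_smul, Scheme.Modules.Hom.app_map_apply,
    Scheme.Modules.Hom.app_map_apply, transpose_app, transpose_app, val_app_star_unitSection,
    val_app_star_unitSection, h i]

end Uniqueness

/-! ### Existence: the dual sections `λ_i` -/

section Existence

variable {E} {U : Y.Opens} {I : Type u} (e : SheafOfModules.free I ≅ E.over U) (i : I)

/-- The values of the double transpose of the `i`-th dual section: `b ↦ f^♯(λ_i(b|_{W ⊓ U}))`
restricted to `U' × f⁻¹W`. [folklore] -/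
def dualTransposeFun (W : Y.Opens) (b : Γ(E, W)) : Γ(X, (f ⁻¹ᵁ U) ⨯ (f ⁻¹ᵁ W)) :=
  f.appLE (W ⊓ U) ((f ⁻¹ᵁ U) ⨯ (f ⁻¹ᵁ W)) (prod_le_preimage_inf W)
    (coord e (homOfLE inf_le_right) (E.presheaf.map (homOfLE inf_le_left).op b) i)

/-- `dualTransposeFun` is additive. [folklore] -/
lemma dualTransposeFun_add (W : Y.Opens) (b b' : Γ(E, W)) :
    dualTransposeFun f e i W (b + b') = dualTransposeFun f e i W b + dualTransposeFun f e i W b' := by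
  simp only [dualTransposeFun, map_add, coord_add]

/-- `dualTransposeFun` is compatible with restriction. [folklore] -/
lemma dualTransposeFun_map {W W' : Y.Opens} (j : W' ⟶ W) (b : Γ(E, W)) :
    dualTransposeFun f e i W' (E.presheaf.map j.op b) =
      X.presheaf.map (prod.map (𝟙 _) ((Opens.map f.base).map j)).op (dualTransposeFun f e i W b) := by
  have hl : W' ⊓ U ≤ W ⊓ U := inf_le_inf_right U j.le
  unfold dualTransposeFun
  rw [presheaf_map_map, Subsingleton.elim (homOfLE (inf_le_left : W' ⊓ U ≤ W') ≫ j)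
    (homOfLE hl ≫ homOfLE (inf_le_left : W ⊓ U ≤ W)), ← presheaf_map_map,
    Subsingleton.elim (homOfLE (inf_le_right : W' ⊓ U ≤ U)) (homOfLE hl ≫ homOfLE inf_le_right),
    coord_map]
  change (Y.presheaf.map (homOfLE hl).op ≫ f.appLE (W' ⊓ U) _ _) _ =
    (f.appLE (W ⊓ U) _ _ ≫ X.presheaf.map _) _
  rw [Scheme.Hom.map_appLE, Scheme.Hom.appLE_map]

/-- `dualTransposeFun` is `f^♯`-semilinear. [folklore] -/
lemma dualTransposeFun_smul (W : Y.Opens) (r : Γ(Y, W)) (b : Γ(E, W)) :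
    dualTransposeFun f e i W (r • b) =
      f.appLE W ((f ⁻¹ᵁ U) ⨯ (f ⁻¹ᵁ W)) (prod.snd (X := f ⁻¹ᵁ U) (Y := f ⁻¹ᵁ W)).le r *
        dualTransposeFun f e i W b := by
  unfold dualTransposeFun
  rw [Scheme.Modules.map_smul, coord_smul, map_mul]
  congr 1
  change (Y.presheaf.map (homOfLE inf_le_left).op ≫ f.appLE (W ⊓ U) _ _) r = _
  rw [Scheme.Hom.map_appLE]

/-- **The double transpose of the `i`-th dual section**, as a morphism of `𝒪_Y`-modules
`E → f_*(overExtend (𝒪|_{f⁻¹U}))`: `b ↦ f^♯(λ_i(b|_{W ⊓ U}))`. [folklore] -/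
def dualTranspose : E ⟶ (Scheme.Modules.pushforward f).obj
    ((overExtend (f ⁻¹ᵁ U)).obj ((unitModule X).over (f ⁻¹ᵁ U))) where
  val := PresheafOfModules.homMk
    { app := fun W => AddCommGrpCat.ofHom
        { toFun := fun b => (dualTransposeFun f e i W.unop b : Γ(X, (f ⁻¹ᵁ U) ⨯ (f ⁻¹ᵁ W.unop)))
          map_zero' := by
            have h := dualTransposeFun_add f e i W.unop 0 0
            rw [add_zero] at h
            exact left_eq_add.mp h
          map_add' := dualTransposeFun_add f e i W.unop }
      naturality := fun {W W'} j => by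
        ext b
        exact dualTransposeFun_map f e i j.unop b }
    (fun W r b => by
      change dualTransposeFun f e i W.unop (r • b) =
        X.presheaf.map (prod.snd : (f ⁻¹ᵁ U) ⨯ (f ⁻¹ᵁ W.unop) ⟶ f ⁻¹ᵁ W.unop).op (f.app W.unop r) *
          dualTransposeFun f e i W.unop b
      exact dualTransposeFun_smul f e i W.unop r b)

/-- Sections of `dualTranspose`. [folklore] -/
lemma dualTranspose_app (W : Y.Opens) (b : Γ(E, W)) :
    (dualTranspose f e i).app W b = dualTransposeFun f e i W b := rfl

/-- **The `i`-th dual section** `λ_i : (f^*E)|_{f⁻¹U} → 𝒪|_{f⁻¹U}` of the pulled-back frame, obtained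
from `dualTranspose` by the two adjunctions. [folklore] -/
def dualSection : ((Scheme.Modules.pullback f).obj E).over (f ⁻¹ᵁ U) ⟶ (unitModule X).over (f ⁻¹ᵁ U) :=
  ((overAdj (f ⁻¹ᵁ U)).homEquiv _ _).symm
    (((Scheme.Modules.pullbackPushforwardAdjunction f).homEquiv _ _).symm (dualTranspose f e i))

/-- The double transpose of `λ_i` is `dualTranspose`. [folklore] -/
lemma transpose_dualSection : transpose f E (f ⁻¹ᵁ U) (dualSection f e i) = dualTranspose f e i := by
  simp only [transpose, dualSection, Equiv.apply_symm_apply]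

/-- Restriction along a morphism of opens with a morphism in the opposite direction is injective.
[folklore] -/
lemma injective_presheaf_map_of_hom {V V' : X.Opens} (g : V ⟶ V') (g' : V' ⟶ V) :
    Function.Injective (X.presheaf.map g.op) := by
  intro a b h
  have key : ∀ c, X.presheaf.map g'.op (X.presheaf.map g.op c) = c := fun c => by
    rw [← CommRingCat.comp_apply, ← X.presheaf.map_comp, ← op_comp,
      Subsingleton.elim (g' ≫ g) (𝟙 _), op_id, X.presheaf.map_id]
    rfl
  have h1 : X.presheaf.map g'.op (X.presheaf.map g.op a) =
    X.presheaf.map g'.op (X.presheaf.map g.op b) := by rw [h]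
  rwa [key, key] at h1

/-- **The dual sections are dual to the pulled-back frame**: `λ_i(η(b_j)) = δ_{ij}`. [folklore] -/
theorem appLE_dualSection_unitSection [DecidableEq I] (j : I) :
    appLE (dualSection f e i) (𝟙 (f ⁻¹ᵁ U)) (unitSection f E U (basisSection e j)) =
      (if j = i then 1 else 0 : Γ(X, f ⁻¹ᵁ U)) := by
  have key := transpose_app f E (f ⁻¹ᵁ U) (dualSection f e i) U (basisSection e j)
  rw [transpose_dualSection, dualTranspose_app, val_app_star_unitSection] at key
  -- `key : f^♯(λ^E_i(b_j|_{U ⊓ U})) = (λ_i(η b_j))|_{U' × U'}`; restriction to `U' × U'` is injective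
  apply injective_presheaf_map_of_hom (prod.fst : (f ⁻¹ᵁ U) ⨯ (f ⁻¹ᵁ U) ⟶ f ⁻¹ᵁ U)
    (prod.lift (𝟙 _) (𝟙 _))
  refine key.symm.trans ?_
  unfold dualTransposeFun
  rw [coord_map_basisSection]
  change (f.appLE (U ⊓ U) _ _).hom _ = (X.presheaf.map _).hom _
  split_ifs
  · rw [map_one, map_one]
  · rw [map_zero, map_zero]

/-- **Existence.** For every `i` there is a morphism `λ_i : (f^*E)|_{f⁻¹U} → 𝒪|_{f⁻¹U}` with
`λ_i(η(b_j)) = δ_{ij}`. [folklore] -/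
theorem exists_dualSection [DecidableEq I] (i : I) :
    ∃ lam : ((Scheme.Modules.pullback f).obj E).over (f ⁻¹ᵁ U) ⟶ (unitModule X).over (f ⁻¹ᵁ U),
      ∀ j, appLE lam (𝟙 (f ⁻¹ᵁ U)) (unitSection f E U (basisSection e j)) =
        (if j = i then 1 else 0 : Γ(X, f ⁻¹ᵁ U)) :=
  ⟨dualSection f e i, appLE_dualSection_unitSection f e i⟩

end Existence

end Literature.AlgebraicGeometry.Modules

end
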